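import Mathlib
import HarnessLib
import Summits.HubbardSuperconductivity.HubbardSuperconductivity.Theorems.KLProgrammeKLRegimeCountertermJacksonRemainderCertAnNear
import Summits.HubbardSuperconductivity.HubbardSuperconductivity.Theorems.KLProgrammeKLRegimeCountertermJacksonRemainderCertAnFar
import Summits.HubbardSuperconductivity.HubbardSuperconductivity.Theorems.KLProgrammeKLRegimeCountertermJacksonRemainderCertAnDefs
import Summits.HubbardSuperconductivity.HubbardSuperconductivity.Theorems.KLProgrammeKLRegimeCountertermJacksonRemainderCertFrameDefs
import Summits.HubbardSuperconductivity.HubbardSuperconductivity.Theorems.KLProgrammeKLRegimeCountertermJacksonTransportMoment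
import Summits.HubbardSuperconductivity.HubbardSuperconductivity.Theorems.KLProgrammeH10TwoPointLimitPerturbedCountPairsThinRanges

/-!
# (C1) ANALYTIC CERTIFICATE at deep scales, part 4 — ASSEMBLY: `CutoffDefectCertFrame d A (klC1TableAn d δ₀ ulo ρf D)` for EVERY degree `d`

Cell `gate-hubbard-kl`, seat hubbard-kl-k3c3-p3 (g12), `--supports stmt-HubbardSuperconductivity-20437` (stub (C) of `KLRegimeEngineV17F2`),
located item «(C1)-DEEP-AN».  From UNIFORM data over the frame class `‖Dʲ evalM K′‖ ≤ A j` — a radius floor `ulo ≤ u_{K′}(θ)` with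
`u_{K′}(θ) + 2δ₀ < π`, `4δ₀ < ulo`, uniform curve jets `‖(k_F^{K′})^{(i)}(θ)‖ ≤ D i`, the near square inside the flat tube
(`4δ₀ + A 0 ≤ klFlatR`), and the tube floor `ρf² ≤ 4 + μ − 2·klFlatR` — k3c3-p1's certificate hypothesis holds with the closed-form table
`klC1TableAn` (…CertAnDefs): majorants = near-field slopes × `(|s| + |t|)` (moment `π√3/(d+1)`), the transport row against the TANGENTIAL moment
`π√3/(2(d+1))` (…JacksonTransportMoment), plus far constants × the far indicator (mass `klC1FarMass d δ₀`); pointwise domination for a.e.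
displacement (k3c3-p1's `ae_jmeas_offGridSlit`) by the near rows (…CertAnNear), the far jets / vanishing alternative (…CertAnFar) and the cutoff
rows (…CertAnalyticCutoff).  The frame-class instance (radius floor and curve jets from the window certificate) is the next file.

Assembly only; no definitions; nothing here asserts stub (C), K3 or superconductivity.
-/

noncomputable section

namespace Summit.HubbardSuperconductivity.HubbardSuperconductivity.Theorems.KLRegimeSplit

set_option linter.dupNamespace false -- summit = problem name (single-conjunct summit), D-0017

open Real Set Filter MeasureTheory
open scoped Topology
open Literature.MathematicalPhysics.QuantumLattice Literature.MathematicalPhysics.QuantumLattice.BandSectorCounting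
open Summit.HubbardSuperconductivity.HubbardSuperconductivity.Theorems.PerturbedFermiCurve

/-! ## §1 Small facts about the vocabulary -/

/-- `P_{j,l}` is monotone in nonnegative jets (it reads orders `1 … 4` only). -/
theorem bellP_mono {X Y : ℕ → ℝ} (hX : ∀ m, 0 ≤ X m) (hXY : ∀ m, 1 ≤ m → m ≤ 4 → X m ≤ Y m) (j l : ℕ) :
    bellP j l X ≤ bellP j l Y := by
  have x1 := hX 1; have x2 := hX 2; have x3 := hX 3
  have y1 := hXY 1 le_rfl (by norm_num); have y2 := hXY 2 (by norm_num) (by norm_num)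
  have y3 := hXY 3 (by norm_num) (by norm_num); have y4 := hXY 4 (by norm_num) le_rfl
  have hY1 : 0 ≤ Y 1 := x1.trans y1
  have hY2 : 0 ≤ Y 2 := x2.trans y2
  unfold bellP
  split
  · exact le_rfl
  · exact y1
  · exact y2
  · exact pow_le_pow_left₀ x1 y1 2
  · exact y3
  · gcongr
  · exact pow_le_pow_left₀ x1 y1 3
  · exact y4
  · gcongr
  · gcongr
  · exact pow_le_pow_left₀ x1 y1 4
  · exact le_rfl

/-- The far indicator sum `J_w = 𝟙_{δ₀<|s|} + 𝟙_{δ₀<|t|}` is nonnegative. -/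
theorem jfarSum_nonneg (δ₀ : ℝ) (w : ℝ × ℝ) :
    0 ≤ Set.indicator {s : ℝ | δ₀ < |s|} (1 : ℝ → ℝ) w.1 + Set.indicator {s : ℝ | δ₀ < |s|} (1 : ℝ → ℝ) w.2 :=
  add_nonneg (jfar_nonneg _ _) (jfar_nonneg _ _)

/-- Nonnegativity of the table's building blocks for nonnegative data. -/
theorem klC1An_nonneg {D : ℕ → ℝ} (hD0 : ∀ i, 0 ≤ D i) {ρ ρf δ₀ : ℝ} (hρ : 0 < ρ) (hρf : 0 < ρf) (hδ₀ : 0 ≤ δ₀) :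
    (∀ m, 0 ≤ klC1AnLam D ρ m) ∧ (∀ m, 0 ≤ klC1AnXfar D ρf m) ∧ (∀ i, 0 ≤ klC1AnCut D i) ∧ (∀ k l, 0 ≤ klC1AnTn D ρ δ₀ k l) := by
  have d1 := hD0 1; have d2 := hD0 2; have d3 := hD0 3; have d4 := hD0 4
  have hL : ∀ m, 0 ≤ klC1AnLam D ρ m := fun m => by unfold klC1AnLam; split_ifs <;> positivity
  refine ⟨hL, fun m => ?_, fun i => ?_, fun k l => ?_⟩
  · unfold klC1AnXfar; split_ifs <;> positivity
  · unfold klC1AnCut; split_ifs <;> positivity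
  · have l1 := hL 1; have l2 := hL 2; have l3 := hL 3; have l4 := hL 4
    unfold klC1AnTn; split_ifs <;> positivity

/-- The far mass is positive. -/
theorem klC1FarMass_pos (d : ℕ) {δ₀ : ℝ} (hδ₀ : 0 < δ₀) : 0 < klC1FarMass d δ₀ := by
  unfold klC1FarMass; positivity

/-! ## §2 The angular rows at ONE displacement (near square / tube / off-tube) -/

section Pointwise

variable {r : ℝ → ℝ} (hr : ContDiff ℝ 4 r) {θ μ : ℝ} (hu : 0 < r θ) {δ₀ : ℝ} (hδ₀ : 0 < δ₀) (hδu : 4 * δ₀ < r θ)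
  (hfold : r θ + 2 * δ₀ < π) {A₀ : ℝ} (hlev : ∀ ϑ, |freeBandFn (r ϑ • dir ϑ) - μ| ≤ A₀) (hnear : 4 * δ₀ + A₀ ≤ klFlatR)
  {D : ℕ → ℝ} (hD0 : ∀ i, 0 ≤ D i) (hD : ∀ i, 1 ≤ i → i ≤ 4 → ‖iteratedDeriv i (certCurve r) θ‖ ≤ D i)
  {ρ : ℝ} (hρ : 0 < ρ) (hρle : ρ ≤ r θ - 2 * δ₀) {ρf : ℝ} (hρf : 0 < ρf) (hρf2 : ρf ^ 2 ≤ 4 + μ - 2 * klFlatR)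
  {w : ℝ × ℝ}
  (hgrid : ∀ i : Fin 2, toIocMod Real.two_pi_pos (-Real.pi) (WithLp.ofLp (certCurve r θ - jshift w) i) ≠ -Real.pi + 2 * Real.pi)
  (hslit : toIocMod Real.two_pi_pos (-Real.pi) (WithLp.ofLp (certCurve r θ - jshift w) 1) ≠ 0)
include hr hu hδ₀ hδu hfold hlev hnear hD0 hD hρ hρle hρf hρf2 hgrid hslit

/-- **The angular rows (`Mc`, `Tt`, `Tu`, `Td`) at one displacement off the grid and the cut**: near square ⇒ near slopes × `(|s|+|t|)`
(and vanishing cutoff jets); off the square, on the tube ⇒ far constants × `J_w` (`J_w ≥ 1` there); off the tube ⇒ the cutoff factors vanish. -/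
theorem certAn_rows_pointwise :
    (∀ k i l, 1 ≤ i → i < k → k ≤ 4 → 1 ≤ l → l ≤ k - i →
      |iteratedDeriv i (certCutoff μ r w) θ| * bellP (k - i) l (certAngleJets r w θ) ≤
        klC1AnCut D i * bellP (k - i) l (klC1AnXfar D ρf) *
          (Set.indicator {s : ℝ | δ₀ < |s|} (1 : ℝ → ℝ) w.1 + Set.indicator {s : ℝ | δ₀ < |s|} (1 : ℝ → ℝ) w.2)) ∧
    (∀ k l, 1 ≤ l → l < k → k ≤ 4 →
      |certCutoff μ r w θ| * bellP k l (certAngleJets r w θ) ≤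
        klC1AnTn D ρ δ₀ k l * (|w.1| + |w.2|) + bellP k l (klC1AnXfar D ρf) *
          (Set.indicator {s : ℝ | δ₀ < |s|} (1 : ℝ → ℝ) w.1 + Set.indicator {s : ℝ | δ₀ < |s|} (1 : ℝ → ℝ) w.2)) ∧
    (∀ k : ℕ, 1 ≤ k → k ≤ 4 →
      |certCutoff μ r w θ| * |iteratedDeriv 1 (certAngle r w) θ ^ k - 1| ≤
        (k : ℝ) * klC1AnLam D ρ 1 * (1 + 2 * δ₀ * klC1AnLam D ρ 1) ^ k * (|w.1| + |w.2|) + (klC1AnXfar D ρf 1 ^ k + 1) *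
          (Set.indicator {s : ℝ | δ₀ < |s|} (1 : ℝ → ℝ) w.1 + Set.indicator {s : ℝ | δ₀ < |s|} (1 : ℝ → ℝ) w.2)) ∧
    (|certCutoff μ r w θ| * |toIocMod Real.two_pi_pos (-π) (certAngle r w θ - θ)| ≤
        |-Real.sin θ * w.1 + Real.cos θ * w.2| / ρ +
          π * (Set.indicator {s : ℝ | δ₀ < |s|} (1 : ℝ → ℝ) w.1 + Set.indicator {s : ℝ | δ₀ < |s|} (1 : ℝ → ℝ) w.2)) := by
  set J : ℝ := Set.indicator {s : ℝ | δ₀ < |s|} (1 : ℝ → ℝ) w.1 + Set.indicator {s : ℝ | δ₀ < |s|} (1 : ℝ → ℝ) w.2 with hJ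
  obtain ⟨hΛ0, hXf0, hc0, hTn0⟩ := klC1An_nonneg hD0 hρ hρf hδ₀.le
  have hJ0 : 0 ≤ J := jfarSum_nonneg δ₀ w
  have hbf0 : ∀ j l, 0 ≤ bellP j l (klC1AnXfar D ρf) := bellP_nonneg hXf0
  have hX0 : ∀ m, 0 ≤ certAngleJets r w θ m := certAngleJets_nonneg r w θ
  have hχ1 : |certCutoff μ r w θ| ≤ 1 := abs_certCutoff_le_one μ r w θ
  have hχ0 : 0 ≤ |certCutoff μ r w θ| := abs_nonneg _
  have hL0 : 0 ≤ |w.1| + |w.2| := by positivity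
  have hT0 : 0 ≤ |-Real.sin θ * w.1 + Real.cos θ * w.2| / ρ := by positivity
  by_cases hwn : |w.1| ≤ δ₀ ∧ |w.2| ≤ δ₀
  · ----------------------------------------------------------------- NEAR SQUARE
    have hw' : 2 * (|w.1| + |w.2|) + A₀ ≤ klFlatR := by linarith [hwn.1, hwn.2]
    have hTt := certAngle_Tt_rows_near hr hu hδ₀.le hδu hfold hwn hslit hD0 hD hρ hρle μ
    obtain ⟨t21, t31, t32, t41, t42, t43⟩ := hTt
    refine ⟨?_, ?_, ?_, ?_⟩
    · intro k i l hi1 _ _ _ _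
      rw [iteratedDeriv_certCutoff_eq_zero_of_near hlev hw' hi1 θ, abs_zero, zero_mul]
      exact mul_nonneg (mul_nonneg (hc0 i) (hbf0 _ _)) hJ0
    · intro k l hl1 hlk hk4
      have hfar0 : 0 ≤ bellP k l (klC1AnXfar D ρf) * J := mul_nonneg (hbf0 k l) hJ0
      suffices h : |certCutoff μ r w θ| * bellP k l (certAngleJets r w θ) ≤ klC1AnTn D ρ δ₀ k l * (|w.1| + |w.2|) by linarith
      interval_cases k <;> interval_cases l <;> simp only [klC1AnTn, klC1AnLam] <;> norm_num <;> assumption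
    · intro k _ _
      have h := certAngle_Tu_rows_near hr hu hδ₀.le hδu hfold hwn hslit hD0 hD hρ hρle μ k
      have hfar0 : 0 ≤ (klC1AnXfar D ρf 1 ^ k + 1) * J := mul_nonneg (by have := hXf0 1; positivity) hJ0
      have e : klC1AnLam D ρ 1 = D 1 / ρ ^ 2 := by simp [klC1AnLam]
      rw [e]; linarith
    · have h := certAngle_Td_row_near hr hu hδu hfold hwn hslit μ
      have hmono : |-Real.sin θ * w.1 + Real.cos θ * w.2| / (r θ - 2 * δ₀) ≤ |-Real.sin θ * w.1 + Real.cos θ * w.2| / ρ :=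
        div_le_div_of_nonneg_left (abs_nonneg _) hρ hρle
      have : 0 ≤ π * J := mul_nonneg Real.pi_pos.le hJ0
      linarith
  · ----------------------------------------------------------------- OFF THE SQUARE
    have hJ1 : 1 ≤ J := one_le_jfar_add_of_not_near hwn
    by_cases hP : ρf ≤ ‖(WithLp.toLp 2 (centredRep (WithLp.ofLp (certCurve r θ - jshift w))) : Momentum)‖
    · -- on the tube: far jets
      obtain ⟨f1, f2, f3, f4⟩ := certAngleJets_far_le hr hgrid hslit hρf hP hD
      have hXle : ∀ m, 1 ≤ m → m ≤ 4 → certAngleJets r w θ m ≤ klC1AnXfar D ρf m := by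
        intro m hm1 hm4
        interval_cases m
        · simpa [klC1AnXfar] using f1
        · simpa [klC1AnXfar] using f2
        · simpa [klC1AnXfar] using f3
        · simpa [klC1AnXfar] using f4
      have hbm : ∀ j l, bellP j l (certAngleJets r w θ) ≤ bellP j l (klC1AnXfar D ρf) := bellP_mono hX0 hXle
      refine ⟨?_, ?_, ?_, ?_⟩
      · intro k i l hi1 hik hk4 _ _
        have hci : |iteratedDeriv i (certCutoff μ r w) θ| ≤ klC1AnCut D i := by
          obtain ⟨b1, b2, b3, b4⟩ := abs_iteratedDeriv_certCutoff_le μ hr w hD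
          have hi4 : i ≤ 4 := by omega
          interval_cases i
          · simpa [klC1AnCut] using b1
          · simpa [klC1AnCut] using b2
          · simpa [klC1AnCut] using b3
          · omega
        calc |iteratedDeriv i (certCutoff μ r w) θ| * bellP (k - i) l (certAngleJets r w θ)
            ≤ klC1AnCut D i * bellP (k - i) l (klC1AnXfar D ρf) :=
              mul_le_mul hci (hbm _ _) (bellP_nonneg hX0 _ _) (hc0 i)
          _ = klC1AnCut D i * bellP (k - i) l (klC1AnXfar D ρf) * 1 := (mul_one _).symm
          _ ≤ klC1AnCut D i * bellP (k - i) l (klC1AnXfar D ρf) * J :=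
              mul_le_mul_of_nonneg_left hJ1 (mul_nonneg (hc0 i) (hbf0 _ _))
      · intro k l _ _ _
        have h1 : |certCutoff μ r w θ| * bellP k l (certAngleJets r w θ) ≤ bellP k l (klC1AnXfar D ρf) * J :=
          calc |certCutoff μ r w θ| * bellP k l (certAngleJets r w θ) ≤ 1 * bellP k l (klC1AnXfar D ρf) :=
                mul_le_mul hχ1 (hbm k l) (bellP_nonneg hX0 _ _) zero_le_one
            _ ≤ bellP k l (klC1AnXfar D ρf) * J := by rw [one_mul]; exact le_mul_of_one_le_right (hbf0 k l) hJ1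
        have h2 : 0 ≤ klC1AnTn D ρ δ₀ k l * (|w.1| + |w.2|) := mul_nonneg (hTn0 k l) hL0
        linarith
      · intro k _ _
        have hx1 : certAngleJets r w θ 1 ≤ klC1AnXfar D ρf 1 := hXle 1 le_rfl (by norm_num)
        have hpow : |iteratedDeriv 1 (certAngle r w) θ ^ k - 1| ≤ klC1AnXfar D ρf 1 ^ k + 1 := by
          calc |iteratedDeriv 1 (certAngle r w) θ ^ k - 1| ≤ |iteratedDeriv 1 (certAngle r w) θ ^ k| + |(1 : ℝ)| := abs_sub _ _
            _ = certAngleJets r w θ 1 ^ k + 1 := by rw [abs_pow, abs_one]; rfl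
            _ ≤ klC1AnXfar D ρf 1 ^ k + 1 := by gcongr; exact hX0 1
        have h1 : |certCutoff μ r w θ| * |iteratedDeriv 1 (certAngle r w) θ ^ k - 1| ≤ (klC1AnXfar D ρf 1 ^ k + 1) * J :=
          calc _ ≤ 1 * (klC1AnXfar D ρf 1 ^ k + 1) := mul_le_mul hχ1 hpow (abs_nonneg _) zero_le_one
            _ ≤ (klC1AnXfar D ρf 1 ^ k + 1) * J := by
                rw [one_mul]; exact le_mul_of_one_le_right (by have := hXf0 1; positivity) hJ1
        have h2 : 0 ≤ k * klC1AnLam D ρ 1 * (1 + 2 * δ₀ * klC1AnLam D ρ 1) ^ k * (|w.1| + |w.2|) := by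
          have := hΛ0 1; positivity
        linarith
      · have h1 : |certCutoff μ r w θ| * |toIocMod Real.two_pi_pos (-π) (certAngle r w θ - θ)| ≤ π * J :=
          calc _ ≤ 1 * π := mul_le_mul hχ1 (abs_toIocMod_two_pi_le_pi _) (abs_nonneg _) zero_le_one
            _ ≤ π * J := by rw [one_mul]; exact le_mul_of_one_le_right Real.pi_pos.le hJ1
        linarith
    · -- off the tube: the cutoff and all its jets vanish at `θ`
      have hz : ∀ i, iteratedDeriv i (certCutoff μ r w) θ = 0 := certCutoff_jets_eq_zero_of_norm_lt hr hρf2 (not_le.1 hP)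
      have hχz : |certCutoff μ r w θ| = 0 := by
        have := hz 0; rw [iteratedDeriv_zero] at this; rw [this, abs_zero]
      refine ⟨?_, ?_, ?_, ?_⟩
      · intro k i l _ _ _ _ _
        rw [hz i, abs_zero, zero_mul]; exact mul_nonneg (mul_nonneg (hc0 i) (hbf0 _ _)) hJ0
      · intro k l _ _ _
        rw [hχz, zero_mul]; exact add_nonneg (mul_nonneg (hTn0 k l) hL0) (mul_nonneg (hbf0 k l) hJ0)
      · intro k _ _
        rw [hχz, zero_mul]
        have := hΛ0 1; have := hXf0 1
        positivity
      · rw [hχz, zero_mul]; positivity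

end Pointwise

/-! ## §3 The assembly -/

/-- **THE ANALYTIC (C1) CERTIFICATE, EVERY JACKSON DEGREE.**  Uniform frame-class data ⟹ `CutoffDefectCertFrame d A (klC1TableAn d δ₀ ulo ρf D)`. -/
theorem cutoffDefectCertFrame_analytic_of_uniform (d : ℕ) {A : ℕ → ℝ} {δ₀ ulo ρf : ℝ} {D : ℕ → ℝ}
    (hδ₀ : 0 < δ₀) (hδ₁ : δ₀ ≤ 1) (hnear : 4 * δ₀ + A 0 ≤ klFlatR) (hulo : 4 * δ₀ < ulo) (hρf : 0 < ρf)
    (hρf2 : ∀ μ ∈ klWindowC, ρf ^ 2 ≤ 4 + μ - 2 * klFlatR) (hD0 : ∀ i, 0 ≤ D i)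
    (hframe : ∀ μ ∈ klWindowC, ∀ K' : TrigPolyC4v,
      (∀ j ≤ 4, ∀ p : EuclideanSpace ℝ (Fin 2), ‖iteratedFDeriv ℝ j (fun q : EuclideanSpace ℝ (Fin 2) => K'.eval (WithLp.ofLp q)) p‖ ≤ A j) →
      ContDiff ℝ 4 (perturbedFermiRadius (fun p => -K'.eval p) μ) →
      (∀ ϑ : ℝ, freeBandFn (klFermiPoint μ K' ϑ) - μ = K'.eval (klFermiPoint μ K' ϑ)) →
      ∀ θ : ℝ, ulo ≤ perturbedFermiRadius (fun p => -K'.eval p) μ θ ∧ perturbedFermiRadius (fun p => -K'.eval p) μ θ + 2 * δ₀ < π ∧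
        ∀ i, 1 ≤ i → i ≤ 4 → ‖iteratedDeriv i (certCurve (perturbedFermiRadius (fun p => -K'.eval p) μ)) θ‖ ≤ D i) :
    CutoffDefectCertFrame d A (klC1TableAn d δ₀ ulo ρf D) := by
  intro μ hμ K' hA hr hcurve θ _
  set r : ℝ → ℝ := perturbedFermiRadius (fun p => -K'.eval p) μ with hrdef
  obtain ⟨hulo', hfold, hD⟩ := hframe μ hμ K' hA hr hcurve θ
  have hu : 0 < r θ := by linarith
  have hδu : 4 * δ₀ < r θ := by linarith
  set ρ : ℝ := ulo - 2 * δ₀ with hρdef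
  have hρ : 0 < ρ := by rw [hρdef]; linarith
  have hρle : ρ ≤ r θ - 2 * δ₀ := by rw [hρdef]; linarith
  -- level closeness along the curve: `|ε(r ϑ dir ϑ) − μ| = |K′(k_F)| ≤ A 0`
  have hlev : ∀ ϑ, |freeBandFn (r ϑ • dir ϑ) - μ| ≤ A 0 := by
    intro ϑ
    have e : r ϑ • dir ϑ = klFermiPoint μ K' ϑ := rfl
    rw [e, hcurve ϑ]
    have h := hA 0 (by norm_num) (WithLp.toLp 2 (klFermiPoint μ K' ϑ))
    rw [norm_iteratedFDeriv_zero] at h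
    simpa using h
  obtain ⟨hΛ0, hXf0, hc0, hTn0⟩ := klC1An_nonneg hD0 hρ hρf hδ₀.le
  have hFM0 : 0 < klC1FarMass d δ₀ := klC1FarMass_pos d hδ₀
  have hbf0 : ∀ j l, 0 ≤ bellP j l (klC1AnXfar D ρf) := bellP_nonneg hXf0
  set J : ℝ × ℝ → ℝ := fun w => Set.indicator {s : ℝ | δ₀ < |s|} (1 : ℝ → ℝ) w.1 + Set.indicator {s : ℝ | δ₀ < |s|} (1 : ℝ → ℝ) w.2
    with hJdef
  -- integrability pieces and the three kernel moments
  have hIJ : Integrable (fun w => jweight d w * J w) jmeas := by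
    have h := (integrable_jweight_mul_jfar_fst d δ₀).add (integrable_jweight_mul_jfar_snd d δ₀)
    refine h.congr (ae_of_all _ fun w => ?_)
    simp only [hJdef, Pi.add_apply]; ring
  have hIL : Integrable (fun w : ℝ × ℝ => jweight d w * (|w.1| + |w.2|)) jmeas :=
    integrable_jmeas_of_continuous ((continuous_jweight d).mul (continuous_fst.abs.add continuous_snd.abs))
  have hIT : Integrable (fun w : ℝ × ℝ => jweight d w * |-Real.sin θ * w.1 + Real.cos θ * w.2|) jmeas :=
    integrable_jmeas_of_continuous ((continuous_jweight d).mul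
      ((continuous_const.mul continuous_fst).add (continuous_const.mul continuous_snd)).abs)
  have hmL : ∫ w, jweight d w * (|w.1| + |w.2|) ∂jmeas ≤ π * Real.sqrt 3 / ((d : ℝ) + 1) := integral_jweight_mul_absSum_le_sharp d
  have hmT : ∫ w, jweight d w * |-Real.sin θ * w.1 + Real.cos θ * w.2| ∂jmeas ≤ π * Real.sqrt 3 / (2 * ((d : ℝ) + 1)) :=
    integral_jweight_mul_abs_perp_le_sharp d θ
  have hmJ : ∫ w, jweight d w * J w ∂jmeas ≤ klC1FarMass d δ₀ := by
    have h := integral_jweight_mul_jfar_le_sharp d hδ₀ hδ₁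
    rw [klC1FarMass]
    refine h.trans (le_of_eq ?_)
    ring
  have momAB : ∀ {a b : ℝ}, 0 ≤ a → 0 ≤ b →
      Integrable (fun w : ℝ × ℝ => jweight d w * (a * (|w.1| + |w.2|) + b * J w)) jmeas ∧
      ∫ w, jweight d w * (a * (|w.1| + |w.2|) + b * J w) ∂jmeas ≤ a * (π * Real.sqrt 3 / ((d : ℝ) + 1)) + b * klC1FarMass d δ₀ := by
    intro a b ha hb
    have e : (fun w : ℝ × ℝ => jweight d w * (a * (|w.1| + |w.2|) + b * J w)) =
        fun w => a * (jweight d w * (|w.1| + |w.2|)) + b * (jweight d w * J w) := by funext w; ring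
    rw [e]
    refine ⟨(hIL.const_mul a).add (hIJ.const_mul b), ?_⟩
    rw [integral_add (hIL.const_mul a) (hIJ.const_mul b), integral_const_mul, integral_const_mul]
    exact add_le_add (mul_le_mul_of_nonneg_left hmL ha) (mul_le_mul_of_nonneg_left hmJ hb)
  have momB : ∀ {b : ℝ}, 0 ≤ b → Integrable (fun w : ℝ × ℝ => jweight d w * (b * J w)) jmeas ∧
      ∫ w, jweight d w * (b * J w) ∂jmeas ≤ b * klC1FarMass d δ₀ := by
    intro b hb
    have e : (fun w : ℝ × ℝ => jweight d w * (b * J w)) = fun w => b * (jweight d w * J w) := by funext w; ring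
    rw [e]
    exact ⟨hIJ.const_mul b, by rw [integral_const_mul]; exact mul_le_mul_of_nonneg_left hmJ hb⟩
  -- the cutoff rows of …CertAnalyticCutoff (every displacement)
  obtain ⟨-, hcutpt, -⟩ := certCutoffRows_analytic d hr hlev hD0 hD hδ₀ hδ₁ hnear (θ := θ)
  refine ⟨fun i w => klC1AnCut D i * J w, fun k i l w => klC1AnCut D i * bellP (k - i) l (klC1AnXfar D ρf) * J w,
    fun k l w => klC1AnTn D ρ δ₀ k l * (|w.1| + |w.2|) + bellP k l (klC1AnXfar D ρf) * J w,
    fun k w => k * klC1AnLam D ρ 1 * (1 + 2 * δ₀ * klC1AnLam D ρ 1) ^ k * (|w.1| + |w.2|) + (klC1AnXfar D ρf 1 ^ k + 1) * J w,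
    fun w => |-Real.sin θ * w.1 + Real.cos θ * w.2| / ρ + π * J w, ?_, ?_, ?_, ?_, ?_, ?_, ?_, ?_, ?_, ?_, ?_, ?_⟩
  -- integrability ×5
  · intro i; exact (momB (hc0 i)).1
  · intro k i l
    have h := (momB (mul_nonneg (hc0 i) (hbf0 (k - i) l))).1
    exact h.congr (ae_of_all _ fun w => by ring)
  · intro k l; exact (momAB (hTn0 k l) (hbf0 k l)).1
  · intro k; exact (momAB (by have := hΛ0 1; positivity) (by have := hXf0 1; positivity)).1
  · have e : (fun w : ℝ × ℝ => jweight d w * (|-Real.sin θ * w.1 + Real.cos θ * w.2| / ρ + π * J w)) =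
        fun w => (1 / ρ) * (jweight d w * |-Real.sin θ * w.1 + Real.cos θ * w.2|) + π * (jweight d w * J w) := by
      funext w; ring
    rw [e]; exact (hIT.const_mul _).add (hIJ.const_mul _)
  -- the a.e. pointwise domination
  · filter_upwards [ae_jmeas_offGridSlit (certCurve r θ)] with w hw
    obtain ⟨hgrid, hslit⟩ := hw
    obtain ⟨hn0, hni⟩ := hcutpt w
    obtain ⟨R3, R4, R5, R6⟩ := certAn_rows_pointwise hr hu hδ₀ hδu hfold hlev hnear hD0 hD hρ hρle hρf (hρf2 μ hμ) hgrid hslit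
    refine ⟨?_, fun i hi1 hi4 => ?_, R3, R4, R5, R6⟩
    · simpa [klC1AnCut] using hn0
    · simpa only [klC1AnCut] using hni i hi1 hi4
  -- the six moment bounds against the table
  · have e : klC1AnCut D 0 = 1 := by simp [klC1AnCut]
    exact (momB (hc0 0)).2.trans (le_of_eq (by rw [e, one_mul]; rfl))
  · intro i _ _; exact (momB (hc0 i)).2
  · intro k i l _ _ _ _ _
    have h := (momB (mul_nonneg (hc0 i) (hbf0 (k - i) l))).2
    refine le_trans (le_of_eq ?_) h
    congr 1
  · intro k l _ _ _
    have h := (momAB (hTn0 k l) (hbf0 k l)).2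
    refine h.trans (le_of_eq ?_)
    show _ = klC1AnTn D (ulo - 2 * δ₀) δ₀ k l * (π * Real.sqrt 3 / ((d : ℝ) + 1)) + bellP k l (klC1AnXfar D ρf) * klC1FarMass d δ₀
    rw [hρdef]
  · intro k _ _
    have h := (momAB (by have := hΛ0 1; positivity : 0 ≤ (k : ℝ) * klC1AnLam D ρ 1 * (1 + 2 * δ₀ * klC1AnLam D ρ 1) ^ k)
      (by have := hXf0 1; positivity : 0 ≤ klC1AnXfar D ρf 1 ^ k + 1)).2
    refine h.trans (le_of_eq ?_)
    show _ = k * klC1AnLam D (ulo - 2 * δ₀) 1 * (1 + 2 * δ₀ * klC1AnLam D (ulo - 2 * δ₀) 1) ^ k * (π * Real.sqrt 3 / ((d : ℝ) + 1)) +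
      (klC1AnXfar D ρf 1 ^ k + 1) * klC1FarMass d δ₀
    rw [hρdef]
  · have e : (fun w : ℝ × ℝ => jweight d w * (|-Real.sin θ * w.1 + Real.cos θ * w.2| / ρ + π * J w)) =
        fun w => (1 / ρ) * (jweight d w * |-Real.sin θ * w.1 + Real.cos θ * w.2|) + π * (jweight d w * J w) := by
      funext w; ring
    rw [e, integral_add (hIT.const_mul _) (hIJ.const_mul _), integral_const_mul, integral_const_mul]
    show _ ≤ π * Real.sqrt 3 / (2 * ((d : ℝ) + 1)) / (ulo - 2 * δ₀) + π * klC1FarMass d δ₀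
    rw [← hρdef]
    have h1 : 1 / ρ * ∫ w, jweight d w * |-Real.sin θ * w.1 + Real.cos θ * w.2| ∂jmeas ≤ π * Real.sqrt 3 / (2 * ((d : ℝ) + 1)) / ρ :=
      calc 1 / ρ * ∫ w, jweight d w * |-Real.sin θ * w.1 + Real.cos θ * w.2| ∂jmeas ≤ 1 / ρ * (π * Real.sqrt 3 / (2 * ((d : ℝ) + 1))) :=
            mul_le_mul_of_nonneg_left hmT (by positivity)
        _ = π * Real.sqrt 3 / (2 * ((d : ℝ) + 1)) / ρ := by ring
    have h2 : π * ∫ w, jweight d w * J w ∂jmeas ≤ π * klC1FarMass d δ₀ := mul_le_mul_of_nonneg_left hmJ Real.pi_pos.le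
    exact add_le_add h1 h2

end Summit.HubbardSuperconductivity.HubbardSuperconductivity.Theorems.KLRegimeSplit

end
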